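import Summits.AtomisticToContinuum.Crystallization.Theorems.FrustratedLawDichotomyStrainedPatchHomEntryTableHcpV

/-!
# `(H) HomFloor m` FROM TWO ∃-TREE FACTS (certificate v8 in the shard currency): the root facts that the address glue of
# `…HomEntrySearchShard` / `…HomEntryTreeShard` delivers are LITERALLY the hypotheses here (this module imports neither; it only restates v8)

decomp-a2c hand-1 g24 (crux `AperiodicFrustratedLawGap`, stmt-AtomisticToContinuum-27623; critic rows 907/910/913/920).  Certificate v8
(`…HomEntryTableHcpV.homFloor_625_of_entrySearches6RBKP_HVK`, namespace `…HomLeafTableCheckHcpV`) consumes two SEARCH Booleans on the root cubes; a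
sharded certificate delivers instead, by decide-free glue, `∃ t, treeOK (entryLeafOK6RBKP μ) t rootC rootW = true` (fcc; tree shards are ×3–6 cheaper
than search shards because `treeOK` evaluates the verdict at leaves only) and `∃ t, treeOK (entryLeafOKHVK μ) t rootCH rootWH = true` (hcp) — or either
side still as a search Boolean (`exists_tree_of_searchOK`).  This module restates v8 for those hypotheses; nothing else changes (same verdicts, same
soundness lemmas `entryLeafOK6RBKP_sound` / `entryLeafOKHVK_sound`, same seam `homFloor_of_prunedBoxSums_selfAdjoint`).

* `fccHalf_of_entryTree6RBKP`, `hcpHalf_of_entryTreeHVK` (tree twins of `fccHalf_of_entrySearch6RBKP` / `hcpHalf_of_entrySearchHVK`);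
* ★★★ `homFloor_of_entryTrees6RBKP_HVK` (every `m`, `μ` with `2(m + e_W)SC ≤ μ`), ★★★ `homFloor_625_of_entryTrees6RBKP_HVK` (TARGET CERTIFICATE v8, ∃-tree
  form), and the mixed forms `homFloor_625_of_entryTree6RBKP_searchHVK` / `homFloor_625_of_search6RBKP_entryTreeHVK`.

0 sorry; standard axioms; no instances / notation / `#eval`.  `--supports stmt-AtomisticToContinuum-27623`.
-/

namespace Summit.AtomisticToContinuum.Crystallization.Theorems.FrustratedLawDichotomyStrainedPatchHomEntryTreeCert

open scoped BigOperators RealInnerProductSpace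
open Literature.Analysis.ValidatedNumerics.Numerics
open Summit.AtomisticToContinuum.Crystallization.Theorems.ChargedEnergyGapNegative (E3)
open Summit.AtomisticToContinuum.Crystallization.Theorems.FrustratedLawDichotomySchurCut (effPot w₄₅ ω₄)
open Summit.AtomisticToContinuum.Crystallization.Theorems.FrustratedLawDichotomyAveragingRuleTightFree (TightNearCap BadNearCap)
open Summit.AtomisticToContinuum.Crystallization.Theorems.FrustratedLawDichotomyExemptAbsorption (ExemptNear)
open Summit.AtomisticToContinuum.Crystallization.Theorems.FrustratedLawDichotomyStrainedPatchHomSplit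
open Summit.AtomisticToContinuum.Crystallization.Theorems.FrustratedLawDichotomyStrainedPatchHomPrunedPolar (homFloor_of_prunedBoxSums_selfAdjoint)
open Summit.AtomisticToContinuum.Crystallization.Theorems.FrustratedLawDichotomyStrainedPatchHomCertTree (CertTree treeOK)
open Summit.AtomisticToContinuum.Crystallization.Theorems.FrustratedLawDichotomyStrainedPatchHomEntryGram (rootC rootW)
open Summit.AtomisticToContinuum.Crystallization.Theorems.FrustratedLawDichotomyStrainedPatchHomEntryGramHcp (rootCH rootWH)
open Summit.AtomisticToContinuum.Crystallization.Theorems.FrustratedLawDichotomyStrainedPatchHomEntryTable (muRec muRec_ok)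
open Summit.AtomisticToContinuum.Crystallization.Theorems.FrustratedLawDichotomyStrainedPatchHomEntrySearch (searchOK exists_tree_of_searchOK)
open Summit.AtomisticToContinuum.Crystallization.Theorems.FrustratedLawDichotomyStrainedPatchHomEntrySign (fccHalf_of_entryTreeDom)
open Summit.AtomisticToContinuum.Crystallization.Theorems.FrustratedLawDichotomyStrainedPatchHomEntryFlipHcp (HcpDich hcpHalf_of_entryTreeShuf)
open Summit.AtomisticToContinuum.Crystallization.Theorems.FrustratedLawDichotomyStrainedPatchHomEntryTableP (entryLeafOK6RBKP entryLeafOK6RBKP_sound)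
open Summit.AtomisticToContinuum.Crystallization.Theorems.FrustratedLawDichotomyStrainedPatchHomLeafTableCheckHcpV (entryLeafOKHVK entryLeafOKHVK_sound)
open Literature.Barriers.AtomisticToContinuum.FlatleyTheil2015 (fccVec)

/-- ★★ The fcc half from ONE certificate TREE with the param-form verdict chain `entryLeafOK6RBKP μ` on the root cube (tree twin of
`…HomEntryTableP.fccHalf_of_entrySearch6RBKP`). [folklore] -/
theorem fccHalf_of_entryTree6RBKP {m : ℝ} {μ : ℤ} (hμ : 2 * (m + (-(7175 / 10000) + 3 / 400)) * SC ≤ μ) {t : CertTree (Fin 3 × Fin 3)}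
    (h : treeOK (entryLeafOK6RBKP μ) t rootC rootW = true) :
    ∀ U : E3 →L[ℝ] E3, (∀ v w : E3, inner ℝ (U v) w = inner ℝ v (U w)) → (∀ w : E3, 0 ≤ inner ℝ w (U w)) → ‖U - 1‖ ≤ 1 / 4 →
      (∀ (M : ℕ) (z : Fin M → E3) (c : Fin M), Function.Injective z →
          Set.range z = {x : E3 | dist x (z c) ≤ 133 / 10 ∧ ∃ a : Fin 3 → ℤ, x = z c + latPt U fccVec a} →
          TightNearCap (9 / 5) (3 / 2) z c ∨ ExemptNear (9 / 5) ExRec z c ∨ BadNearCap (9 / 5) (3 / 2) z c) ∨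
      m ≤ (∑ b ∈ (Fintype.piFinset fun _ : Fin 3 => Finset.Icc (-7 : ℤ) 7).filter (fun b => b ≠ 0),
        effPot w₄₅ ω₄ (3 / 400) ‖latPt U fccVec b‖) / 2 - (-(7175 / 10000) + 3 / 400) :=
  fccHalf_of_entryTreeDom hμ (entryLeafOK6RBKP μ) (fun _ _ hv U hsa hU hbox h1 h2 h01 h02 => entryLeafOK6RBKP_sound hv U hsa hU hbox h1 h2 h01 h02) h

/-- ★★ The hcp half from ONE certificate TREE with hand-2's vector-form verdict `entryLeafOKHVK μ` on the hcp root cube (tree twin of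
`…HomLeafTableCheckHcpV.hcpHalf_of_entrySearchHVK`). [folklore] -/
theorem hcpHalf_of_entryTreeHVK {m : ℝ} {μ : ℤ} (hμ : 2 * (m + (-(7175 / 10000) + 3 / 400)) * SC ≤ μ) {t : CertTree ((Fin 3 × Fin 3) ⊕ Fin 3)}
    (h : treeOK (entryLeafOKHVK μ) t rootCH rootWH = true) :
    ∀ (U : E3 →L[ℝ] E3) (ξ : E3), (∀ v w : E3, inner ℝ (U v) w = inner ℝ v (U w)) → (∀ w : E3, 0 ≤ inner ℝ w (U w)) →
      ‖U - 1‖ ≤ 1 / 4 → ‖ξ‖ ≤ 1 / 4 → HcpDich m U ξ :=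
  hcpHalf_of_entryTreeShuf hμ (entryLeafOKHVK μ) (fun _ _ hv U ξ hsa hU hbox hξ h0 h2 => entryLeafOKHVK_sound hv U ξ hsa hU hbox hξ h0 h2) h

/-- ★★★ **`(H) HomFloor m` FROM TWO ∃-TREE FACTS** (the root facts the shard glue delivers), fcc `entryLeafOK6RBKP μ` and hcp `entryLeafOKHVK μ`; every
`m`, `μ` with `2 (m + e_W) SC ≤ μ`. [folklore] -/
theorem homFloor_of_entryTrees6RBKP_HVK {m : ℝ} {μ : ℤ} (hμ : 2 * (m + (-(7175 / 10000) + 3 / 400)) * SC ≤ μ)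
    (hF : ∃ t : CertTree (Fin 3 × Fin 3), treeOK (entryLeafOK6RBKP μ) t rootC rootW = true)
    (hH : ∃ t : CertTree ((Fin 3 × Fin 3) ⊕ Fin 3), treeOK (entryLeafOKHVK μ) t rootCH rootWH = true) : HomFloor m := by
  obtain ⟨tF, htF⟩ := hF
  obtain ⟨tH, htH⟩ := hH
  exact homFloor_of_prunedBoxSums_selfAdjoint (fccHalf_of_entryTree6RBKP hμ htF) (hcpHalf_of_entryTreeHVK hμ htH)

/-- ★★★ **`(H) HomFloor (1/625)`, TARGET CERTIFICATE v8 IN THE SHARD CURRENCY**: the two root ∃-tree facts at `μ = muRec` give `HomFloor (1/625)`. [folklore] -/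
theorem homFloor_625_of_entryTrees6RBKP_HVK
    (hF : ∃ t : CertTree (Fin 3 × Fin 3), treeOK (entryLeafOK6RBKP muRec) t rootC rootW = true)
    (hH : ∃ t : CertTree ((Fin 3 × Fin 3) ⊕ Fin 3), treeOK (entryLeafOKHVK muRec) t rootCH rootWH = true) : HomFloor (1 / 625) :=
  homFloor_of_entryTrees6RBKP_HVK muRec_ok hF hH

/-- Mixed form: fcc as an ∃-tree fact (sharded), hcp as ONE search Boolean (if the hcp count is small enough for one file). [folklore] -/
theorem homFloor_625_of_entryTree6RBKP_searchHVK
    (hF : ∃ t : CertTree (Fin 3 × Fin 3), treeOK (entryLeafOK6RBKP muRec) t rootC rootW = true)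
    {selH : ℕ → ((Fin 3 × Fin 3) ⊕ Fin 3 → ℤ) → ((Fin 3 × Fin 3) ⊕ Fin 3 → ℤ) → (Fin 3 × Fin 3) ⊕ Fin 3} {fuelH dH : ℕ}
    (hH : searchOK (entryLeafOKHVK muRec) selH fuelH dH rootCH rootWH = true) : HomFloor (1 / 625) :=
  homFloor_625_of_entryTrees6RBKP_HVK hF (exists_tree_of_searchOK _ selH fuelH dH _ _ hH)

/-- Mixed form: fcc as ONE search Boolean, hcp as an ∃-tree fact. [folklore] -/
theorem homFloor_625_of_search6RBKP_entryTreeHVK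
    {selF : ℕ → (Fin 3 × Fin 3 → ℤ) → (Fin 3 × Fin 3 → ℤ) → Fin 3 × Fin 3} {fuelF dF : ℕ}
    (hF : searchOK (entryLeafOK6RBKP muRec) selF fuelF dF rootC rootW = true)
    (hH : ∃ t : CertTree ((Fin 3 × Fin 3) ⊕ Fin 3), treeOK (entryLeafOKHVK muRec) t rootCH rootWH = true) : HomFloor (1 / 625) :=
  homFloor_625_of_entryTrees6RBKP_HVK (exists_tree_of_searchOK _ selF fuelF dF _ _ hF) hH

end Summit.AtomisticToContinuum.Crystallization.Theorems.FrustratedLawDichotomyStrainedPatchHomEntryTreeCert
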